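import Literature.AnabelianGeometry.EtaleTheta.ContH1CoeffChange
import Literature.AnabelianGeometry.EtaleTheta.ContH1ConjAction
import Mathlib.Algebra.Group.Even
import HarnessLib

/-!
# Continuous `H¹`: transport of a `2`-torsion twist across an `l`-isogeny of coefficients (`l` odd)

Neukirch–Schmidt–Wingberg, *Cohomology of Number Fields*, I §2 / II §7 (the exact sequence
`H⁰(H, A'/A) → H¹(H, A) → H¹(H, A')` for abelian coefficients `A ≤ A'`)
[cite: NeukirchSchmidtWingberg2008, I §2 and II §7]; used in [EtTh] §2 for the passage between
`H¹(Π^tp_Ÿ̲̲, l·Δ_Θ)` and `H¹(Π^tp_Ÿ̲̲, Δ_Θ)` (Mochizuki, *The étale theta function …*, Def. 2.7 p. 41: "the class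
`η̈^Θ` determines a class `η̲̈^Θ ∈ H¹(Π^tp_Ÿ̲̲, l·Δ_Θ)` … an `l`-th root … up to multiplication by a root of unity
of order `l`") [cite: MochizukiEtTh2009, Def 2.7 p.41].

PROOF-ONLY supplement (no definitions) to `ContH1CoeffChange.lean` (abc-iut-w4-d014) and `ContH1ConjAction.lean`,
seat abc-iut-L2-t8 (cell abc-iut, layer L2; owner of the `X̲̲`/`l·Δ_Θ` layer `DoubleUnderline.lean`). Two facts of
pure group cohomology, for abelian normal coefficients `A ≤ A' ≤ G'` with the conjugation action through
`φ : G → G'`, a normal `H ≤ G` and `σ ∈ G`: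

* `ContH1.conj_eq_self_of_coeffChange_eq_one` — if `φ(σ)` CENTRALISES `A'`, then `conj σ` fixes the kernel of
  the change of coefficients `H¹(H, A) → H¹(H, A')` pointwise (that kernel consists of the classes of the
  `A`-valued `A'`-coboundaries `∂a'`, and `σ·∂a' = ∂(φ(σ) a' φ(σ)⁻¹) = ∂a'`);
* `ContH1.exists_sq_eq_one_of_conj_coeffChange_eq` — the TRANSPORT: if `conj σ` is an involution on `H¹(H, A)`
  fixing that kernel pointwise, `n` is odd with `(a')ⁿ ∈ A` for all `a' ∈ A'`, and the image of `η ∈ H¹(H, A)` in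
  `H¹(H, A')` is moved by `σ` through a class `κ₀` with `κ₀² = 1`, then `σ·η = η·κ` for a class `κ ∈ H¹(H, A)` with
  `κ² = 1` lifting `κ₀`. (The ambiguity `ν` of a lift is `n`-torsion and satisfies `σ·ν = ν⁻¹` and `σ·ν = ν`,
  hence `ν² = 1 = νⁿ`, so `ν = 1`.)

The consumer is the [EtTh]-model transport `(P14ii-cl) ⇒ hsign` of GAP row G-w4d010-2
(`Literature/IUT/HodgeArakelov/EtaleThetaDataSignTransport.lean`). Elementary; takes no side on anything.
-/

namespace Literature.AnabelianGeometry.EtaleTheta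

open scoped IsMulCommutative

/-! ### Two monoid facts about odd exponents -/

/-- In a monoid, an element with `x² = 1` equals its odd powers. [folklore] -/
private theorem pow_eq_self_of_sq_eq_one_of_odd {M : Type*} [Monoid M] {x : M} {n : ℕ} (hn : Odd n)
    (h2 : x ^ 2 = 1) : x ^ n = x := by
  obtain ⟨k, rfl⟩ := hn
  rw [pow_succ, pow_mul, h2, one_pow, one_mul]

/-- In a monoid, `x² = 1` and `xⁿ = 1` with `n` odd force `x = 1`. [folklore] -/
private theorem eq_one_of_sq_eq_one_of_pow_odd_eq_one {M : Type*} [Monoid M] {x : M} {n : ℕ} (hn : Odd n)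
    (h2 : x ^ 2 = 1) (hn1 : x ^ n = 1) : x = 1 := by
  rw [← pow_eq_self_of_sq_eq_one_of_odd hn h2]
  exact hn1

/-- Group identity behind `σ·∂a' = ∂a'` for `φ(σ)` commuting with `a'`:
`s ((s⁻¹ t s) b (s⁻¹ t s)⁻¹ b⁻¹) s⁻¹ = t b t⁻¹ b⁻¹` when `s b = b s`. [folklore] -/
private theorem conj_coboundary_aux {G : Type*} [Group G] (s t b : G) (hc : Commute s b) :
    s * ((s⁻¹ * t * s) * b * (s⁻¹ * t * s)⁻¹ * b⁻¹) * s⁻¹ = t * b * t⁻¹ * b⁻¹ := by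
  have e1 : s * b * s⁻¹ = b := by rw [hc.eq, mul_inv_cancel_right]
  have e2 : s * b⁻¹ * s⁻¹ = b⁻¹ := by rw [hc.inv_right.eq, mul_inv_cancel_right]
  calc s * ((s⁻¹ * t * s) * b * (s⁻¹ * t * s)⁻¹ * b⁻¹) * s⁻¹
      = t * (s * b * s⁻¹) * t⁻¹ * (s * b⁻¹ * s⁻¹) := by group
    _ = t * b * t⁻¹ * b⁻¹ := by rw [e1, e2]

section Transport

variable {G G' : Type*} [Group G] [TopologicalSpace G] [IsTopologicalGroup G]
  [Group G'] [TopologicalSpace G'] [IsTopologicalGroup G']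
  (φ : G →* G') {A A' : Subgroup G'} [A.Normal] [IsMulCommutative A] [A'.Normal] [IsMulCommutative A']
  (hAA' : A ≤ A') (H : Subgroup G) [H.Normal]

namespace ContH1

/-- **An element whose image centralises the big coefficients fixes `Ker(H¹(H, A) → H¹(H, A'))` pointwise.**
If `φ(σ)` commutes with every element of `A'`, then for every `x ∈ H¹(H, A)` killed by the change of coefficients
along `A ≤ A'` one has `σ·x = x`: such an `x` is the class of an `A`-valued coboundary `h ↦ φ(h) a' φ(h)⁻¹ a'⁻¹`
(`a' ∈ A'`), and conjugating it by `σ` replaces `a'` by `φ(σ) a' φ(σ)⁻¹ = a'`. (In [EtTh]: a GEOMETRIC element of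
`Π^tp_X` acts trivially on `Δ_Θ` — `Δ_Θ` is central in `(Δ^tp_X)^Θ`, §1 p. 12 — hence fixes the `μ_l`-ambiguity
of `l`-th roots.) [cite: NeukirchSchmidtWingberg2008, I §2 and II §7] -/
theorem conj_eq_self_of_coeffChange_eq_one (σ : G) (hσ : ∀ a' : A', Commute (φ σ) (a' : G'))
    (x : ContH1 φ A H) (hx : coeffChange φ hAA' H x = 1) : conj φ A σ x = x := by
  induction x using QuotientGroup.induction_on with
  | H f =>
    have hmem : coeffCocycle φ hAA' H f ∈ (contCoboundaries φ A' H).subgroupOf (contCocycles φ A' H) :=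
      (QuotientGroup.eq_one_iff _).mp hx
    obtain ⟨a', ha'⟩ := (mem_contCoboundaries_iff _).mp (Subgroup.mem_subgroupOf.mp hmem)
    have hval : ∀ k : H, ((f.1 k : A) : G') = φ (k : G) * a' * (φ (k : G))⁻¹ * (a' : G')⁻¹ := by
      intro k
      have := congrArg (fun b : A' => (b : G')) (congrFun ha' k)
      simpa [MulAut.conjNormal_apply] using this
    rw [conj_mk]
    apply congrArg (QuotientGroup.mk (s := (contCoboundaries φ A H).subgroupOf (contCocycles φ A H)))
    apply Subtype.ext
    funext h
    rw [conjCocycle_apply]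
    apply Subtype.ext
    have hcoe : ((MulAut.conjNormal σ⁻¹ h : H) : G) = σ⁻¹ * h * σ := by
      rw [MulAut.conjNormal_apply, inv_inv]
    rw [MulAut.conjNormal_apply, hval, hval, hcoe, map_mul, map_mul, map_inv]
    exact conj_coboundary_aux (φ σ) (φ h) (a' : G') (hσ a')

/-- **Transport of a `2`-torsion twist across `H¹(H, A) → H¹(H, A')`, `A'`/`A` of odd exponent.** Let `σ ∈ G`
act as an involution on `H¹(H, A)` (e.g. `σ² ∈ H`) and fix `Ker(H¹(H, A) → H¹(H, A'))` pointwise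
(`conj_eq_self_of_coeffChange_eq_one`); let `n` be odd with `(a')ⁿ ∈ A` for all `a' ∈ A'` (so that kernel is
`n`-torsion, `ContH1.pow_eq_one_of_coeffChange_eq_one`). If the image `η'` of `η ∈ H¹(H, A)` satisfies
`σ·η' = η'·κ₀` with `κ₀² = 1`, then `σ·η = η·κ` for a (unique) `κ ∈ H¹(H, A)` with `κ² = 1`, and `κ ↦ κ₀`.
PROOF: `λ := σ·η/η ↦ κ₀`; `μ := λⁿ ↦ κ₀ⁿ = κ₀` and `μ² = (λ²)ⁿ = 1` (`λ² ↦ κ₀² = 1`); `ν := λ/μ` is in the kernel,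
`νⁿ = 1`, `σ·ν = ν⁻¹` (from `σ·λ = λ⁻¹`) and `σ·ν = ν`, so `ν² = 1`, `ν = 1`, `λ = μ`. (In [EtTh]: the
`l·Δ_Θ`-level sign `ε·η̲̈^Θ = η̲̈^Θ·κ`, `κ² = 1`, of an `l`-th root `η̲̈^Θ` follows from the `Δ_Θ`-level sign
"`Θ̈(−Ü) = −Θ̈(Ü)`", Prop. 1.4 (ii), with no further input.) [cite: MochizukiEtTh2009, Def 2.7 p.41] -/
theorem exists_sq_eq_one_of_conj_coeffChange_eq {n : ℕ} (hn : Odd n)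
    (hpow : ∀ a' : A', ((a' : G') ^ n) ∈ A) (σ : G)
    (hσσ : ∀ x : ContH1 φ A H, conj φ A σ (conj φ A σ x) = x)
    (hfix : ∀ x : ContH1 φ A H, coeffChange φ hAA' H x = 1 → conj φ A σ x = x)
    (η : ContH1 φ A H) (κ₀ : ContH1 φ A' H) (hκ₀ : κ₀ ^ 2 = 1)
    (h : conj φ A' σ (coeffChange φ hAA' H η) = coeffChange φ hAA' H η * κ₀) :
    ∃ κ : ContH1 φ A H, κ ^ 2 = 1 ∧ coeffChange φ hAA' H κ = κ₀ ∧ conj φ A σ η = η * κ := by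
  -- `λ := σ·η / η` maps to `κ₀` and is inverted by `σ`
  have hlam : coeffChange φ hAA' H (conj φ A σ η / η) = κ₀ := by
    rw [map_div, ← conj_coeffChange, h, mul_div_right_comm, div_self', one_mul]
  have hconj_lam : conj φ A σ (conj φ A σ η / η) = (conj φ A σ η / η)⁻¹ := by
    rw [map_div, hσσ, inv_div]
  -- `μ := λⁿ` maps to `κ₀ⁿ = κ₀` and `μ² = 1`
  have hmu : coeffChange φ hAA' H ((conj φ A σ η / η) ^ n) = κ₀ := by
    rw [map_pow, hlam, pow_eq_self_of_sq_eq_one_of_odd hn hκ₀]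
  have hmu_sq : ((conj φ A σ η / η) ^ n) ^ 2 = 1 := by
    have h2 : coeffChange φ hAA' H ((conj φ A σ η / η) ^ 2) = 1 := by
      rw [map_pow, hlam, hκ₀]
    have h3 := pow_eq_one_of_coeffChange_eq_one φ hAA' H n hpow _ h2
    rw [← pow_mul, mul_comm, pow_mul] at h3
    exact h3
  -- `ν := λ / μ` is in the kernel and `νⁿ = 1`
  have hnu : coeffChange φ hAA' H ((conj φ A σ η / η) / (conj φ A σ η / η) ^ n) = 1 := by
    rw [map_div, hlam, hmu, div_self']
  have hnu_n : ((conj φ A σ η / η) / (conj φ A σ η / η) ^ n) ^ n = 1 := by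
    rw [div_pow, pow_eq_self_of_sq_eq_one_of_odd hn hmu_sq, div_self']
  -- `σ·ν = ν⁻¹` and `σ·ν = ν`, hence `ν² = 1`, `ν = 1`
  have hconj_nu : conj φ A σ ((conj φ A σ η / η) / (conj φ A σ η / η) ^ n) =
      ((conj φ A σ η / η) / (conj φ A σ η / η) ^ n)⁻¹ := by
    rw [map_div, map_pow, hconj_lam, inv_pow, inv_div_inv, inv_div]
  have hnu_sq : ((conj φ A σ η / η) / (conj φ A σ η / η) ^ n) ^ 2 = 1 := by
    rw [pow_two]
    exact mul_eq_one_iff_eq_inv.mpr ((hfix _ hnu).symm.trans hconj_nu)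
  have hnu_one : (conj φ A σ η / η) / (conj φ A σ η / η) ^ n = 1 :=
    eq_one_of_sq_eq_one_of_pow_odd_eq_one hn hnu_sq hnu_n
  -- conclude `λ = μ`
  refine ⟨(conj φ A σ η / η) ^ n, hmu_sq, hmu, ?_⟩
  rw [← div_eq_one.mp hnu_one, ← mul_div_assoc, mul_comm η, mul_div_assoc, div_self', mul_one]

/-- Uniqueness half (for the record): the class `κ` with `σ·η = η·κ` is determined by `η` and `σ`
(`κ = σ·η/η`), so ANY such `κ` has `κ² = 1` under the hypotheses of
`exists_sq_eq_one_of_conj_coeffChange_eq`. [cite: MochizukiEtTh2009, Def 2.7 p.41] -/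
theorem sq_eq_one_of_conj_eq_mul {n : ℕ} (hn : Odd n)
    (hpow : ∀ a' : A', ((a' : G') ^ n) ∈ A) (σ : G)
    (hσσ : ∀ x : ContH1 φ A H, conj φ A σ (conj φ A σ x) = x)
    (hfix : ∀ x : ContH1 φ A H, coeffChange φ hAA' H x = 1 → conj φ A σ x = x)
    (η : ContH1 φ A H) (κ₀ : ContH1 φ A' H) (hκ₀ : κ₀ ^ 2 = 1)
    (h : conj φ A' σ (coeffChange φ hAA' H η) = coeffChange φ hAA' H η * κ₀)
    (κ : ContH1 φ A H) (hκ : conj φ A σ η = η * κ) : κ ^ 2 = 1 ∧ coeffChange φ hAA' H κ = κ₀ := by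
  obtain ⟨κ', hκ'2, hκ'0, hκ'⟩ :=
    exists_sq_eq_one_of_conj_coeffChange_eq φ hAA' H hn hpow σ hσσ hfix η κ₀ hκ₀ h
  have : κ = κ' := mul_left_cancel (hκ.symm.trans hκ')
  subst this
  exact ⟨hκ'2, hκ'0⟩

end ContH1

end Transport

end Literature.AnabelianGeometry.EtaleTheta
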